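import Literature.RepresentationTheory.Semisimple.ProductGroupIrreducibles
import Literature.RepresentationTheory.CompactGroups.OuterTensorProductIrreducibles
import HarnessLib

/-!
# Outer tensor products `π ⊗ σ` of `ContRepresentation`s over `ℂ` for ARBITRARY groups:
# irreducibility, uniqueness of the factors, and the converse — no compactness, no Haar measure

Topic `Literature/RepresentationTheory/CompactGroups` (namespace `Literature.RepresentationTheory.CompactGroups.Schur`,
continuing `OuterTensorProduct` / `OuterTensorProductIrreducibles`); theorems only, no definition, no named fact.

The tree's Bröcker–tom Dieck II (4.14)–(4.15) files prove, for the bundled outer tensor product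
`ContRepresentation.outerTensor`: `π ⊗ σ` irreducible (`Schur.isIrreducible_outerTensor` — `G`, `K` compact
second countable, `π`, `σ` continuous unitary, via `∫ |χ|² = 1`), injectivity of `(π, σ) ↦ π ⊗ σ`
(`nonempty_equiv_left/right_of_equiv_outerTensor` — a compact factor, continuity, unitarity, via character
orthogonality) and "every irreducible of `G × H` is `π ⊗ σ`" (`exists_equiv_outerTensor` — `H` compact Hausdorff,
`U` continuous unitary).  The algebraic file `Semisimple/ProductGroupIrreducibles` (Bump 1997 Prop. 3.4.2 =
Bourbaki *Algèbre* VIII §7.7; Goodman–Wallach Prop. 4.2.5: Burnside–Schur–Jacobson density) gives all three for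
Mathlib `Representation`s of ARBITRARY groups; this file reads them back on `ContRepresentation.outerTensor`
(`toRepresentation_outerTensor_apply`), so that every hypothesis on the groups, on continuity and on unitarity
disappears (finite-dimensionality of the complex inner-product spaces is what remains):

* `isIrreducible_outerTensor'` — **`π ⊗ σ` is irreducible for irreducible `π`, `σ`, any groups**;
  `isIrreducible_outerTensor_iff` — and conversely (with the tree's `isIrreducible_left/right_of_isIrreducible_outerTensor`);
* `nonempty_equiv_left_of_equiv_outerTensor'`, `nonempty_equiv_right_of_equiv_outerTensor'` — **(4.15) injectivity,
  any groups**: `π ⊗ σ ≃ π' ⊗ σ'` forces `π ≃ π'` (`F ≠ 0`) and `σ ≃ σ'` (`E ≠ 0`);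
* `exists_equiv_outerTensor'` — **every irreducible `U` of `G × H` on a finite-dimensional inner product space is
  `π ⊗ σ`**, realised on `V, W ⊆ X` with `π g = U(g, 1)|_V`, `σ h = U(1, h)|_W`, any groups;
* `exists_areUnitarilyEquivalent_outerTensor'` — for unitary `U` the equivalence is unitary and `π`, `σ` are unitary
  (Deitmar–Echterhoff Cor. 6.1.9 through the tree's `Schur.areUnitarilyEquivalent_of_equiv`).

## References
* T. Bröcker, T. tom Dieck, *Representations of Compact Lie Groups*, GTM 98 (1985), II Prop. (4.14), (4.15), PDF p. 80
  [BrockerTomDieck1985].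
* D. Bump, *Automorphic Forms and Representations* (1997), §3.4 Prop. 3.4.2, PDF p. 302 [Bump1997].
* R. Goodman, N. R. Wallach, *Symmetry, Representations, and Invariants*, GTM 255 (2009), Prop. 4.2.5 [GoodmanWallachGTM255].
* A. Deitmar, S. Echterhoff, *Principles of Harmonic Analysis*, 2nd ed. (2014), Cor. 6.1.9 [DeitmarEchterhoff2014].

## Provenance
Lane `lit-hodgefound` (HOME `run/shared/lean/pub/lit-hodgefound/`), prover seat `lit-hodgefound-p05` generation 8 (Layer 0
beneath C2-08 / C2-10).
-/

noncomputable section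

open ContRepresentation
open scoped InnerProductSpace TensorProduct

namespace Literature.RepresentationTheory.CompactGroups

namespace Schur

/-! ### `π ⊗ σ` is irreducible iff `π` and `σ` are — any groups, no unitarity, no continuity -/

section Irreducible

variable {G K : Type*} [Group G] [Group K]
variable {E F : Type*} [NormedAddCommGroup E] [InnerProductSpace ℂ E] [FiniteDimensional ℂ E]
  [NormedAddCommGroup F] [InnerProductSpace ℂ F] [FiniteDimensional ℂ F]
variable {π : ContRepresentation ℂ G E} {σ : ContRepresentation ℂ K F}

/-- **`π ⊗ σ` is irreducible for irreducible `π`, `σ` — ANY groups `G`, `K`**, no Haar measure, no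
continuity, no unitarity (Burnside–Schur–density instead of character orthogonality; the compact case
is `Schur.isIrreducible_outerTensor`). (Bump 1997, Prop. 3.4.2 = Bourbaki *Algèbre* VIII §7.7;
Goodman–Wallach Prop. 4.2.5; Bröcker–tom Dieck II (4.14) for compact groups.)
[cite: Bump1997, Proposition 3.4.2] [cite: BrockerTomDieck1985, II Prop (4.14)] -/
theorem isIrreducible_outerTensor' [π.toRepresentation.IsIrreducible] [σ.toRepresentation.IsIrreducible] :
    (π.outerTensor σ).toRepresentation.IsIrreducible :=
  Semisimple.isIrreducible_of_forall_eq_tensorProduct_map_of_isAlgClosed π.toRepresentation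
    σ.toRepresentation (π.outerTensor σ).toRepresentation
    fun g k => toRepresentation_outerTensor_apply (π := π) (σ := σ) (g, k)

/-- **`π ⊗ σ` is irreducible iff `π` and `σ` are** (any groups; `⇒` is `isIrreducible_left/right_of_
isIrreducible_outerTensor`, the factors being non-zero because `E ⊗ F` is). [cite: Bump1997, Proposition 3.4.2]
[cite: BrockerTomDieck1985, II Prop (4.14)] -/
theorem isIrreducible_outerTensor_iff :
    (π.outerTensor σ).toRepresentation.IsIrreducible ↔
      π.toRepresentation.IsIrreducible ∧ σ.toRepresentation.IsIrreducible := by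
  refine ⟨fun h => ?_, fun ⟨hπ, hσ⟩ => isIrreducible_outerTensor'⟩
  haveI hEF : Nontrivial (E ⊗[ℂ] F) :=
    IsSimpleModule.nontrivial (MonoidAlgebra ℂ (G × K)) (π.outerTensor σ).toRepresentation.asModule
  haveI : Nontrivial E := by
    by_contra hE
    rw [not_nontrivial_iff_subsingleton] at hE
    exact false_of_nontrivial_of_subsingleton (E ⊗[ℂ] F)
  haveI : Nontrivial F := by
    by_contra hF
    rw [not_nontrivial_iff_subsingleton] at hF
    exact false_of_nontrivial_of_subsingleton (E ⊗[ℂ] F)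
  exact ⟨isIrreducible_left_of_isIrreducible_outerTensor (σ := σ) h,
    isIrreducible_right_of_isIrreducible_outerTensor (π := π) h⟩

end Irreducible

/-! ### Uniqueness of the factors — any groups -/

section Unique

variable {G K : Type*} [Group G] [Group K]
variable {E F E' F' : Type*} [NormedAddCommGroup E] [InnerProductSpace ℂ E]
  [NormedAddCommGroup F] [InnerProductSpace ℂ F]
  [NormedAddCommGroup E'] [InnerProductSpace ℂ E'] [NormedAddCommGroup F'] [InnerProductSpace ℂ F']
variable {π : ContRepresentation ℂ G E} {σ : ContRepresentation ℂ K F}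
  {π' : ContRepresentation ℂ G E'} {σ' : ContRepresentation ℂ K F'}

/-- **Bröcker–tom Dieck (4.15), injectivity in the first factor — ANY groups**: `π ⊗ σ ≃ π' ⊗ σ'` with
`π`, `π'` irreducible and `F ≠ 0` forces `π ≃ π'` (no measure, continuity or unitarity; the compact
version is `nonempty_equiv_left_of_equiv_outerTensor`). [cite: Bump1997, Proposition 3.4.2]
[cite: BrockerTomDieck1985, II Prop (4.14)] -/
theorem nonempty_equiv_left_of_equiv_outerTensor' [Nontrivial F] [FiniteDimensional ℂ F']
    [π.toRepresentation.IsIrreducible]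
    [π'.toRepresentation.IsIrreducible]
    (e : (π.outerTensor σ).toRepresentation.Equiv (π'.outerTensor σ').toRepresentation) :
    Nonempty (π.toRepresentation.Equiv π'.toRepresentation) :=
  Semisimple.nonempty_equiv_left_of_equiv_tensorProduct (σ := σ.toRepresentation)
    (σ' := σ'.toRepresentation)
    (fun g k => toRepresentation_outerTensor_apply (π := π) (σ := σ) (g, k))
    (fun g k => toRepresentation_outerTensor_apply (π := π') (σ := σ') (g, k)) e

/-- **Bröcker–tom Dieck (4.15), injectivity in the second factor — ANY groups**: `π ⊗ σ ≃ π' ⊗ σ'`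
with `σ`, `σ'` irreducible and `E ≠ 0` forces `σ ≃ σ'`. [cite: Bump1997, Proposition 3.4.2]
[cite: BrockerTomDieck1985, II Prop (4.14)] -/
theorem nonempty_equiv_right_of_equiv_outerTensor' [Nontrivial E] [FiniteDimensional ℂ E']
    [σ.toRepresentation.IsIrreducible]
    [σ'.toRepresentation.IsIrreducible]
    (e : (π.outerTensor σ).toRepresentation.Equiv (π'.outerTensor σ').toRepresentation) :
    Nonempty (σ.toRepresentation.Equiv σ'.toRepresentation) :=
  Semisimple.nonempty_equiv_right_of_equiv_tensorProduct (ρ := π.toRepresentation)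
    (ρ' := π'.toRepresentation)
    (fun g k => toRepresentation_outerTensor_apply (π := π) (σ := σ) (g, k))
    (fun g k => toRepresentation_outerTensor_apply (π := π') (σ := σ') (g, k)) e

end Unique

/-! ### Every irreducible of `G × H` is `π ⊗ σ` — any groups -/

section Converse

variable {G H : Type*} [Group G] [Group H]
variable {X : Type*} [NormedAddCommGroup X] [InnerProductSpace ℂ X] [FiniteDimensional ℂ X]

/-- **Bröcker–tom Dieck II (4.14), second half, for ARBITRARY groups**: every irreducible
representation `U` of `G × H` (as a `ContRepresentation` over `ℂ` on a finite-dimensional inner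
product space, no topology on the groups, no continuity, no unitarity) is equivalent to an outer
tensor product `π ⊗ σ` of irreducibles, realised on subspaces `V, W ⊆ X` with `π g = U(g, 1)|_V`,
`σ h = U(1, h)|_W` (the compact-`H` version with continuity and unitarity is
`exists_equiv_outerTensor`).  From the algebraic `Semisimple.exists_subrepresentation_equiv_tensorProduct`
(Bump Prop. 3.4.1–3.4.2 / Goodman–Wallach Prop. 4.2.5). [cite: Bump1997, Proposition 3.4.2]
[cite: BrockerTomDieck1985, II Prop (4.14)] -/
theorem exists_equiv_outerTensor' (U : ContRepresentation ℂ (G × H) X) [U.toRepresentation.IsIrreducible] :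
    ∃ (V W : Submodule ℂ X) (π : ContRepresentation ℂ G V) (σ : ContRepresentation ℂ H W),
      π.toRepresentation.IsIrreducible ∧ σ.toRepresentation.IsIrreducible ∧
      (∀ (g : G) (v : V), (π g v : X) = U (g, 1) v) ∧ (∀ (h : H) (w : W), (σ h w : X) = U (1, h) w) ∧
      Nonempty ((π.outerTensor σ).toRepresentation.Equiv U.toRepresentation) := by
  obtain ⟨M, N, π₀, hM, hN, hπ₀, ⟨e⟩⟩ :=
    Semisimple.exists_subrepresentation_equiv_tensorProduct U.toRepresentation
  set UG : ContRepresentation ℂ G X := U.restrict (MonoidHom.inl G H) with hUG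
  set UH : ContRepresentation ℂ H X := U.restrict (MonoidHom.inr G H) with hUH
  let 𝒱 : ClosedSubrep UG := ClosedSubrep.ofSubmodule M.toSubmodule
    (Submodule.closed_of_finiteDimensional _) fun g v hv => M.apply_mem_toSubmodule g hv
  let 𝒲 : ClosedSubrep UH := ClosedSubrep.ofSubmodule N.toSubmodule
    (Submodule.closed_of_finiteDimensional _) fun h w hw => N.apply_mem_toSubmodule h hw
  let π : ContRepresentation ℂ G M.toSubmodule := 𝒱.toContRep
  let σ : ContRepresentation ℂ H N.toSubmodule := 𝒲.toContRep
  have hπM : ∀ g : G, (π g : M.toSubmodule →ₗ[ℂ] M.toSubmodule) = M.toRepresentation g :=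
    fun g => LinearMap.ext fun v => Subtype.ext rfl
  have hσN : ∀ h : H, (σ h : N.toSubmodule →ₗ[ℂ] N.toSubmodule) = N.toRepresentation h :=
    fun h => LinearMap.ext fun w => Subtype.ext rfl
  have hrep : ∀ gh : G × H,
      ((π.outerTensor σ).toRepresentation : Representation ℂ (G × H) (M.toSubmodule ⊗[ℂ] N.toSubmodule)) gh =
        π₀ gh := by
    rintro ⟨g, h⟩
    rw [toRepresentation_outerTensor_apply, hπ₀, hπM, hσN]
  have hπeq : π.toRepresentation = M.toRepresentation := MonoidHom.ext fun g => hπM g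
  have hσeq : σ.toRepresentation = N.toRepresentation := MonoidHom.ext fun h => hσN h
  refine ⟨M.toSubmodule, N.toSubmodule, π, σ, ?_, ?_, fun g v => rfl, fun h w => rfl,
    ⟨Representation.Equiv.mk e.toLinearEquiv fun gh => ?_⟩⟩
  · rw [hπeq]; exact hM
  · rw [hσeq]; exact hN
  · rw [hrep]
    exact e.toIntertwiningMap.isIntertwining' gh

/-- **(4.14)–(4.15) on unitary duals, ANY groups**: an irreducible UNITARY `U` of `G × H` on a
finite-dimensional inner product space is UNITARILY equivalent to `π ⊗ σ` with `π`, `σ` irreducible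
unitary, `π g = U(g, 1)|_V`, `σ h = U(1, h)|_W` (Deitmar–Echterhoff Cor. 6.1.9 normalises the
algebraic equivalence: `Schur.areUnitarilyEquivalent_of_equiv`; the compact-`H` version is
`exists_areUnitarilyEquivalent_outerTensor`). [cite: BrockerTomDieck1985, II Prop (4.14)]
[cite: DeitmarEchterhoff2014, Cor. 6.1.9] -/
theorem exists_areUnitarilyEquivalent_outerTensor' (U : ContRepresentation ℂ (G × H) X)
    [U.toRepresentation.IsIrreducible] (hUu : ∀ (gh : G × H) (x y : X), ⟪U gh x, U gh y⟫_ℂ = ⟪x, y⟫_ℂ) :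
    ∃ (V W : Submodule ℂ X) (π : ContRepresentation ℂ G V) (σ : ContRepresentation ℂ H W),
      π.toRepresentation.IsIrreducible ∧ σ.toRepresentation.IsIrreducible ∧
      (∀ (g : G) (v w : V), ⟪π g v, π g w⟫_ℂ = ⟪v, w⟫_ℂ) ∧ (∀ (h : H) (v w : W), ⟪σ h v, σ h w⟫_ℂ = ⟪v, w⟫_ℂ) ∧
      (∀ (g : G) (v : V), (π g v : X) = U (g, 1) v) ∧ (∀ (h : H) (w : W), (σ h w : X) = U (1, h) w) ∧
      ContRepresentation.AreUnitarilyEquivalent (π.outerTensor σ) U := by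
  obtain ⟨V, W, π, σ, hπi, hσi, hπU, hσU, ⟨e⟩⟩ := exists_equiv_outerTensor' U
  have hπu : ∀ (g : G) (v w : V), ⟪π g v, π g w⟫_ℂ = ⟪v, w⟫_ℂ := fun g v w => by
    rw [Submodule.coe_inner, Submodule.coe_inner, hπU, hπU, hUu]
  have hσu : ∀ (h : H) (v w : W), ⟪σ h v, σ h w⟫_ℂ = ⟪v, w⟫_ℂ := fun h v w => by
    rw [Submodule.coe_inner, Submodule.coe_inner, hσU, hσU, hUu]
  haveI := hπi
  haveI := hσi
  refine ⟨V, W, π, σ, hπi, hσi, hπu, hσu, hπU, hσU, ?_⟩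
  exact (areUnitarilyEquivalent_of_equiv hUu (ContRepresentation.inner_outerTensor_apply_apply π σ hπu hσu)
    e.symm).symm

end Converse

end Schur

end Literature.RepresentationTheory.CompactGroups

end
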